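import Literature.Computability.Complexity.BinarySearchPP
import Literature.Computability.Complexity.GF2StringArith
import Literature.Computability.Complexity.CodeFPStrings
import Literature.Computability.Complexity.CodeFPArith
import Literature.Computability.Complexity.CodeFPLists
import Literature.Computability.Complexity.LundEtAl1992Proofs
import Summits.PneNP.PneNP.Theorems.PermanentDescentCollapseMakesPermanentEasyDefs
import Mathlib.LinearAlgebra.Matrix.Permanent

/-!
# Route PermanentDescent, crux `PermanentNotInP` (stmt-PneNP-16143), line `Sketch` (xp-ladder) —
# side stub `stub_permBits_mem_PRelClass_PP_of_sharpP`: the UPPER bound `PermBits ∈ P^{PP}`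

The crux language `PermBits = {⟨s, bin i⟩ : |s| = n², bit i of perm_ℕ(M_s) = 1}` is calibrated from
ABOVE: if the permanent of the crux's 0/1 word matrix is a witness count of a polynomial-time
relation `V` at witness length `|x|` on every query `x = ⟨s, bin i⟩` (the antecedent, supplied by the
neighbouring stub `stub_permSharpP`), then `PermBits ∈ P^{PP}`.

Proof (Arora–Barak 2009, §17.2.1, proof of Lemma 17.7: binary search with `PP` threshold questions).
The tree's `BinSearchPP.countsLang_mem_PRelClass_PP hV hE r` puts
`{x | ⟨x, ⟨natBits D #V(x,[1]), natBits D #V(x,[0])⟩⟩ ∈ E} ∈ P^{PP}` for every post-processing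
language `E ∈ P`, `D = r(|x|) + 1`. With `r = X` the first count is `#V(x, [1])` at witness length
`|x|`, i.e. `perm_ℕ(M_s)` by the antecedent (tag `t = [1]`). The post-processing language
`E = {z | wfB (fst z) ∧ (fst (snd z))[⟦snd (fst z)⟧] = 1}` parses the query `x = fst z` by the total
projections (`PermCert.wfB`: `x` re-pairs to itself and `|s|` is a perfect square) and reads digit
`i = ⟦snd x⟧` of the first numeral; it is cut out by a bit of the typed polynomial-time calculus
`CodeFP`, hence in `P` (`LFKN.setOf_codeFP_mem_P`). Digit `i` of `natBits D c` is bit `i` of `c`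
(`GF2Str.getD_natBits`) because `c = #V(x,[1]) < 2^D` (`BinSearchPP.val_lt`), so the language of the
binary search IS `PermBits` (`Set.ext`).

Lead prover-line-stmt-PneNP-16143-c2-0, `--supports stmt-PneNP-16143`.
-/

set_option linter.dupNamespace false -- `Summit.PneNP.PneNP.…`: summit = sub-problem name (D-0017 single-conjunct layout)

namespace Summit.PneNP.PneNP.Theorems.XpLadder

open _root_.Computability Literature.Computability.Complexity Literature.Computability.Complexity.Brick
  Literature.Computability.Complexity.CodeFP Summit.PneNP.PneNP.Theorems.PermCert

/-! ### §1 Digits of fixed-width numerals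

The entries of the width-`D` little-endian numeral `natBits D c` are the bits of `c` below the width:
the tree's `GF2Str.getD_natBits` (`GF2StringArith.lean`). -/

/-- A set bit `i` of a number `< 2ᴰ` has `i < D`. [folklore] -/
theorem lt_of_testBit_of_lt_two_pow {c D i : ℕ} (hc : c < 2 ^ D) (hbit : c.testBit i = true) : i < D := by
  by_contra hle
  have hci : c < 2 ^ i := lt_of_lt_of_le hc (Nat.pow_le_pow_right two_pos (Nat.le_of_not_lt hle))
  rw [Nat.testBit_eq_false_of_lt hci] at hbit
  exact Bool.false_ne_true hbit

/-! ### §2 The post-processing language is in `P` -/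

/-- **Well-formedness of queries is polynomial time on codes** (`PermCert.wfB`: `x` re-pairs to
itself through the total projections and `|fstF x|` is a perfect square).
[cite: AroraBarak2009, §1.3 (composition of polynomial-time functions)] -/
theorem wfB_codeFP : CodeFP strE bitE wfB := by
  -- adapted from `rungOneDecider_codeFP` (PermanentDescentPermanentNotInPLadderBase.lean)
  have hs : CodeFP strE strE fstF := of_fn fstF fstF_mem_FP fun _ => rfl
  have ht : CodeFP strE strE sndF := of_fn sndF sndF_mem_FP fun _ => rfl
  have hi : CodeFP strE natE (fun x => bitsToNat (sndF x)) := strVal.comp ht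
  have hlenU : CodeFP strE unE (fun x => (fstF x).length) := strLength.comp hs
  have hlen : CodeFP strE natE (fun x => (fstF x).length) := (natOfUn.comp hlenU :)
  have hrepair : CodeFP strE strE (fun x => boolPair (fstF x) (encodeNat (bitsToNat (sndF x)))) :=
    (transparent (eα := pairE strE natE) (eβ := strE) (g := fun p => boolPair p.1 (encodeNat p.2))
      fun _ => rfl).comp (hs.pair hi)
  have heq : CodeFP strE bitE
      (fun x => decide (boolPair (fstF x) (encodeNat (bitsToNat (sndF x))) = x)) :=
    (CodeFP.eq (eα := strE) fun _ _ h => h).comp (hrepair.pair (CodeFP.id strE))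
  have hsq : CodeFP strE bitE (fun x =>
      decide (Nat.sqrt (fstF x).length * Nat.sqrt (fstF x).length = (fstF x).length)) :=
    natEq.comp ((natMul.comp ((natSqrt.comp hlen).pair (natSqrt.comp hlen))).pair hlen)
  exact (heq.and hsq).congr fun x => by simp only [wfB, Bool.decide_and]

/-- **The post-processing bit is polynomial time on codes**: on `z = ⟨x, ⟨A, B⟩⟩` test `wfB x` and
read the letter of `A` at position `⟦sndF x⟧`. [cite: AroraBarak2009, §1.3 (composition of polynomial-time functions)] -/
theorem postBit_codeFP :
    CodeFP strE bitE (fun z => wfB (fstF z) && (fstF (sndF z)).getD (bitsToNat (sndF (fstF z))) false) := by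
  have hs : CodeFP strE strE fstF := of_fn fstF fstF_mem_FP fun _ => rfl
  have ht : CodeFP strE strE sndF := of_fn sndF sndF_mem_FP fun _ => rfl
  have hwf : CodeFP strE bitE (fun z => wfB (fstF z)) := wfB_codeFP.comp hs
  have hA : CodeFP strE strE (fun z => fstF (sndF z)) := hs.comp ht
  have hi : CodeFP strE natE (fun z => bitsToNat (sndF (fstF z))) := strVal.comp (ht.comp hs)
  have hbit : CodeFP strE bitE (fun z => (fstF (sndF z)).getD (bitsToNat (sndF (fstF z))) false) :=
    strGetDNat.comp (hA.pair hi)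
  exact hwf.and hbit

/-- Membership of a triple `⟨x, ⟨A, B⟩⟩` in the post-processing language `E`: the query `x` is well
formed and the letter of `A` at position `⟦sndF x⟧` is `1`. [folklore] -/
theorem mem_postLang_iff (x A B : List Bool) :
    @Membership.mem (List Bool) (Language Bool) _
        {z | (wfB (fstF z) && (fstF (sndF z)).getD (bitsToNat (sndF (fstF z))) false) = true}
        (boolPair x (boolPair A B)) ↔
      wfB x = true ∧ A.getD (bitsToNat (sndF x)) false = true := by
  change (wfB (fstF (boolPair x (boolPair A B))) &&
      (fstF (sndF (boolPair x (boolPair A B)))).getD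
        (bitsToNat (sndF (fstF (boolPair x (boolPair A B))))) false) = true ↔ _
  simp only [fstF_boolPair, sndF_boolPair, Bool.and_eq_true]

/-- **The post-processing language `E` is in `P`.** [cite: AroraBarak2009, Def. 1.13] -/
theorem postLang_mem_P :
    ({z | (wfB (fstF z) && (fstF (sndF z)).getD (bitsToNat (sndF (fstF z))) false) = true} :
      Language Bool) ∈ Classes.P :=
  LFKN.setOf_codeFP_mem_P postBit_codeFP

/-! ### §3 `PermBits ∈ P^{PP}` from the witness count -/

/-- The first searched count at `r = X` is the witness count at witness length `|x|` with tag `[1]`.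
[folklore] -/
theorem cntV_X (V : Language Bool) (x t : List Bool) :
    ThresholdPP.cntV V Polynomial.X x t = countWitnesses V x.length (boolPair x t) := by
  rw [ThresholdPP.cntV, Polynomial.eval_X]

/-- The first searched count is below `2^D`, `D = |x| + 1`. [folklore] -/
theorem cntV_X_lt (V : Language Bool) (x : List Bool) (b : Bool) :
    ThresholdPP.cntV V Polynomial.X x [b] < 2 ^ (x.length + 1) := by
  have h := BinSearchPP.val_lt V Polynomial.X x b
  rwa [BinSearchPP.val, Polynomial.eval_X] at h

/-- **Side stub `stub_permBits_mem_PRelClass_PP_of_sharpP` (c2): `PermBits ∈ P^{PP}` from the witness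
count** — binary search with the `PP` threshold oracle recovers all digits of the count
(`BinSearchPP.countsLang_mem_PRelClass_PP`), and a polynomial-time post-processing reads bit `i`.
[cite: AroraBarak2009, Lemma 17.7 (proof)] -/
theorem stub_permBits_mem_PRelClass_PP_of_sharpP :
    (∃ V : Language Bool, V ∈ Literature.Computability.Complexity.Classes.P ∧
      ∀ (n : ℕ) (s : List Bool) (i : ℕ) (t : List Bool), s.length = n * n →
        Literature.Computability.Complexity.countWitnesses V
            (Literature.Computability.Complexity.boolPair s (Computability.encodeNat i)).length
            (Literature.Computability.Complexity.boolPair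
              (Literature.Computability.Complexity.boolPair s (Computability.encodeNat i)) t) =
          Matrix.permanent (Matrix.of fun a b : Fin n =>
            if s.getD ((b : ℕ) + n * (a : ℕ)) false then (1 : ℕ) else 0)) →
    ({w | ∃ (n : ℕ) (s : List Bool) (i : ℕ), s.length = n * n ∧ w = Literature.Computability.Complexity.boolPair s (Computability.encodeNat i) ∧ Nat.testBit (Matrix.permanent (Matrix.of fun a b : Fin n => if s.getD ((b : ℕ) + n * (a : ℕ)) false then (1 : ℕ) else 0)) i = true} : Language Bool)
      ∈ Literature.Computability.Complexity.PRelClass Literature.Computability.Complexity.PP := by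
  rintro ⟨V, hV, hcount⟩
  have hmain := BinSearchPP.countsLang_mem_PRelClass_PP hV postLang_mem_P Polynomial.X
  convert hmain using 1
  refine Set.ext fun x => ?_
  simp only [Set.mem_setOf_eq, mem_postLang_iff, Polynomial.eval_X]
  constructor
  · -- a member `⟨s, bin i⟩` of `PermBits` is well formed and digit `i` of the first count is set
    rintro ⟨n, s, i, hs, rfl, hbit⟩
    have hsq : Nat.sqrt (n * n) = n := Nat.sqrt_eq n
    have hwf : wfB (boolPair s (encodeNat i)) = true := by
      simp only [wfB, fstF_boolPair, sndF_boolPair, bitsToNat_encodeNat, hs, hsq, and_self, decide_true]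
    refine ⟨hwf, ?_⟩
    rw [sndF_boolPair, bitsToNat_encodeNat, GF2Str.getD_natBits, cntV_X, hcount n s i [true] hs, hbit,
      Bool.and_true, decide_eq_true_iff]
    refine lt_of_testBit_of_lt_two_pow ?_ hbit
    have hlt := cntV_X_lt V (boolPair s (encodeNat i)) true
    rwa [cntV_X, hcount n s i [true] hs] at hlt
  · -- a well-formed query whose digit is set is a member of `PermBits`
    rintro ⟨hwf, hget⟩
    simp only [wfB, decide_eq_true_eq] at hwf
    obtain ⟨hpair, hsq⟩ := hwf
    refine ⟨Nat.sqrt (fstF x).length, fstF x, bitsToNat (sndF x), hsq.symm, hpair.symm, ?_⟩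
    rw [GF2Str.getD_natBits, Bool.and_eq_true, cntV_X] at hget
    have hc := hcount (Nat.sqrt (fstF x).length) (fstF x) (bitsToNat (sndF x)) [true] hsq.symm
    rw [hpair] at hc
    rw [← hc]
    exact hget.2

end Summit.PneNP.PneNP.Theorems.XpLadder
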